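import Summits.HodgeConjecture.CorCM.GaloisDegenerateSplitExtension
import Summits.HodgeConjecture.CorCM.GaloisLeftStabiliserInducedType
import Mathlib.GroupTheory.SchurZassenhaus
import HarnessLib

/-!
# BAD ascends from every coprime (Hall) quotient of odd kernel: `N ◁ Gal(K/ℚ)` of odd order prime to its index and
# `K^N` BAD ⟹ `K` BAD — no splitting hypothesis (Schur–Zassenhaus)

COR-CM (cell `pub-hodgecm2`), binder seat b04 (gen 31), count-neutral own lane «Galois-CM-type classification»; sequel of
`CorCM/GaloisDegenerateSplitExtension`.  KERNEL ONLY: theorems; no definition, no named fact, no `sorry`.  `HC_CM` is neither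
used nor claimed.

THE POINT.  Gen 31's monotonicity theorem needs the restriction `Gal(K/ℚ) → Gal(K₀/ℚ)` to SPLIT through complex conjugation.
When the kernel `N = Gal(K/K₀)` has odd order prime to its index, BOTH requirements are automatic:
* SCHUR–ZASSENHAUS (Mathlib `Subgroup.exists_right_complement'_of_coprime`): `N` has a complement `Γ`;
* `complexConj_mem_complement_of_odd`: a CENTRAL INVOLUTION lies in EVERY complement of a normal subgroup of odd order
  (`c = n γ` ⟹ `γ² = n⁻² ∈ N ∩ Γ = 1` ⟹ `n = 1`).
Moreover `K^N` is then a Galois CM field (Mathlib `IsGalois.of_fixedField_normal_subgroup`; CM because `c ∉ N` moves an element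
of `K^N`: gen 21 `GaloisRank.isCMField_fixedField_of_not_mem`), and `[K : K^N] = |N| ≥ 3`.

THEOREM (**`exists_simple_degenerate_of_fixedField_coprime_odd`**).  `K` a Galois CM field, `N ◁ Gal(K/ℚ)` with `|N|` odd,
`N ≠ 1`, `gcd(|N|, [Gal : N]) = 1`; if the fixed field `K^N` has a PRIMITIVE DEGENERATE
CM type, then `K` carries a SIMPLE DEGENERATE abelian variety of dimension `[K:ℚ]/2` with CM by `K` (a rational `(p,p)` class
outside the divisor ring on some power).  In particular (`N` = a normal Sylow `p`-subgroup, `p` odd; `N = O_{p}(G)` when Hall;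
`N` = the odd part of a nilpotent Galois group): **GOOD(K) ⟹ GOOD(K^N)** for every such `N` — if the Hodge rings of all powers of
all simple CM abelian varieties with CM by `K` are generated by divisor classes (`B = D`), then so are those with CM by `K^N` (BAD =
an exceptional Hodge class on some power, whose algebraicity stays open).  Examples: every Galois CM field
with group `C_p^a ⋊ P` (`P` a `2`-group ∋ `c`, any action) over a BAD `P`-field; `A ⋊ Q₁₆`-fields are not constrained (`Q₁₆`
GOOD), `A ⋊ SD₁₆`-, `A ⋊ M₁₆`-, `A ⋊ (ℤ/8 × ℤ/2, c ∉ ℤ/8)`-fields (`|A|` odd) are all BAD.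

## References

* [Kubota1965] T. Kubota, *On the field extension by complex multiplication*, Trans. AMS 118 (1965), §2, §4 Lemma 2.
* [Shimura1998] G. Shimura, *Abelian Varieties with Complex Multiplication and Modular Functions*, §6.2 Thm. 3, §8.2 Prop. 26,
  §18.2 Lemma (i).
* [Gordon1999HodgeAVSurvey] B. B. Gordon, *A survey of the Hodge conjecture for abelian varieties*, Thm. 6.4, §9.3.
* [Streng2010] M. Streng, *Complex multiplication of abelian surfaces*, Ch. I Lemma 2.2 (d).
-/

noncomputable section

open CategoryTheory CategoryTheory.Limits NumberField
open scoped BigOperators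

namespace Summit.HodgeConjecture.CorCM.GaloisModels

open Literature.NumberTheory.ComplexMultiplication
open Literature.AlgebraicGeometry.Motives (AbelianVariety CMType)
open Literature.AlgebraicGeometry.HodgeTheory
open Literature.AlgebraicGeometry.ComplexMultiplication (IsCMTypeRealisation)
open Literature.AlgebraicGeometry.Pohlmann1968
open Literature.Barriers.HodgeConjecture (divisorClassesSpan)
open Summit.HodgeConjecture.CorCM.GaloisRank

/-! ## §1 A central involution lies in every complement of a normal subgroup of odd order -/

section Group

variable {G : Type*} [Group G]

/-- **A central involution lies in every complement of a normal subgroup of odd order**: `c = n γ` with `n ∈ N`, `γ ∈ Γ` gives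
`γ² = n⁻²` in `N ∩ Γ = 1`, so `n² = 1` and `n = 1` (odd order). [folklore] -/
theorem mem_complement_of_odd {N Γ : Subgroup G} (hNΓ : Subgroup.IsComplement' N Γ) (hodd : Odd (Nat.card N)) {c : G}
    (hcomm : ∀ g : G, c * g = g * c) (hcc : c * c = 1) : c ∈ Γ := by
  obtain ⟨⟨n, γ⟩, hnγ, -⟩ := Subgroup.isComplement'_def.1 hNΓ |>.existsUnique c
  simp only at hnγ
  -- `γ = n⁻¹ c`, `γ² = n⁻²`
  have hγ : (γ : G) = (n : G)⁻¹ * c := by rw [← hnγ, inv_mul_cancel_left]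
  have hγ2 : (γ : G) * γ = (n : G)⁻¹ * (n : G)⁻¹ := by
    rw [hγ, mul_assoc, ← mul_assoc c, hcomm, mul_assoc, hcc, mul_one]
  -- both sides lie in `N ∩ Γ = ⊥`
  have hmemΓ : (n : G)⁻¹ * (n : G)⁻¹ ∈ Γ := by rw [← hγ2]; exact Γ.mul_mem γ.2 γ.2
  have hmemN : (n : G)⁻¹ * (n : G)⁻¹ ∈ N := N.mul_mem (N.inv_mem n.2) (N.inv_mem n.2)
  have hone : (n : G)⁻¹ * (n : G)⁻¹ = 1 := by
    have := hNΓ.disjoint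
    rw [Subgroup.disjoint_def] at this
    exact this hmemN hmemΓ
  -- `n` has order dividing `2` and odd order, so `n = 1`
  have hn2 : (n⁻¹ : N) * n⁻¹ = 1 := Subtype.ext (by simpa using hone)
  have hord : orderOf (n⁻¹ : N) ∣ 2 := orderOf_dvd_of_pow_eq_one (by rw [pow_two]; exact hn2)
  have hord' : orderOf (n⁻¹ : N) ∣ Nat.card N := orderOf_dvd_natCard _
  have h1 : orderOf (n⁻¹ : N) = 1 := by
    have hodd' : Odd (orderOf (n⁻¹ : N)) := hodd.of_dvd_nat hord'
    rcases (Nat.dvd_prime Nat.prime_two).1 hord with h | h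
    · exact h
    · exact absurd (h ▸ hodd') (by decide)
  rw [orderOf_eq_one_iff, inv_eq_one] at h1
  rw [← hnγ, h1, Subgroup.coe_one, one_mul]
  exact γ.2

end Group

/-! ## §2 The theorem -/

section Field

variable {K : Type} [Field K] [NumberField K] [IsCMField K] [IsGalois ℚ K]

/-- **BAD ASCENDS FROM EVERY COPRIME QUOTIENT OF ODD KERNEL.**  `K` Galois CM, `N ◁ Gal(K/ℚ)`, `|N|` odd, `N ≠ 1`,
`gcd(|N|, [Gal(K/ℚ) : N]) = 1`; `K^N` (a Galois CM field) has a PRIMITIVE DEGENERATE CM type ⟹ `K` carries a SIMPLE DEGENERATE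
abelian variety of dimension `[K:ℚ]/2` with CM by `K` (a rational `(p,p)` class outside the divisor ring on some power).
Schur–Zassenhaus supplies the complement, which contains complex conjugation automatically.
[cite: Kubota1965, §2 and §4 Lemma 2] [cite: Shimura1998, §6.2 Thm. 3 and §8.2 Prop. 26] [cite: Gordon1999HodgeAVSurvey, Thm. 6.4 and §9.3] -/
theorem exists_simple_degenerate_of_fixedField_coprime_odd (N : Subgroup (K ≃ₐ[ℚ] K)) [N.Normal]
    (hodd : Odd (Nat.card N)) (hN : N ≠ ⊥) (hcop : Nat.Coprime (Nat.card N) N.index)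
    (Φ₀ : CMType (IntermediateField.fixedField N)) (φ₀ : IntermediateField.fixedField N →+* ℂ)
    (hprim : IsPrimitive (ℂ ≃+* ℂ) Φ₀.1 φ₀) (hndg : ¬ IsNondegenerate Φ₀) :
    ∃ (Φ : CMType K) (φ : K →+* ℂ) (X : AbelianVariety ℂ) (ι : 𝓞 K →+* End X)
      (ϑ : K →+* Module.End ℂ (complexBetti X.X 1)),
      IsPrimitive (ℂ ≃+* ℂ) Φ.1 φ ∧ ¬ IsNondegenerate Φ ∧ IsCMTypeRealisation Φ X ι ϑ ∧ X.IsSimple ∧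
      X.dim = Module.finrank ℚ K / 2 ∧
      ∃ m p : ℕ, ∃ y : complexBetti (⨁ fun _ : Fin m => X).X (2 * p), IsRationalClass y ∧
        IsOfHodgeType (⨁ fun _ : Fin m => X).dim (⨁ fun _ : Fin m => X).X (2 * p) p p y ∧
        y ∉ divisorClassesSpan (⨁ fun _ : Fin m => X).X (⨁ fun _ : Fin m => X).dim p := by
  have hcomm := model_complexConj_comm (K := K) (MulEquiv.refl _) rfl
  have hcc := model_complexConj_mul_self (K := K) (MulEquiv.refl _) rfl
  have hc1 := model_complexConj_ne_one (K := K) (MulEquiv.refl _) rfl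
  rw [MulEquiv.refl_apply] at hcc hc1
  -- complex conjugation is not in `N` (odd order), so `K^N` is a CM field
  have hcN : (IsCMField.complexConj K).restrictScalars ℚ ∉ N := fun hc => by
    have h2 : orderOf ((IsCMField.complexConj K).restrictScalars ℚ) = 2 :=
      orderOf_eq_prime (by rw [pow_two]; exact hcc) hc1
    have hd : orderOf ((IsCMField.complexConj K).restrictScalars ℚ) ∣ Nat.card N := by
      have := orderOf_dvd_natCard (⟨_, hc⟩ : N)
      rwa [← Subgroup.orderOf_coe] at this
    rw [h2] at hd
    exact (Nat.not_even_iff_odd.2 hodd) (even_iff_two_dvd.2 hd)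
  haveI : IsCMField (IntermediateField.fixedField N) := isCMField_fixedField_of_not_mem N hcN
  -- Schur–Zassenhaus
  obtain ⟨Γ, hNΓ⟩ := Subgroup.exists_right_complement'_of_coprime hcop
  -- complex conjugation lies in `Γ`
  have hcΓ : (IsCMField.complexConj K).restrictScalars ℚ ∈ Γ :=
    mem_complement_of_odd hNΓ hodd (fun g => by simpa using hcomm g) hcc
  -- degrees
  have hNpos : 0 < Nat.card N := Nat.card_pos
  have hidx : N.index = Module.finrank ℚ (IntermediateField.fixedField N) := by
    have h1 : N.index * Nat.card N = Module.finrank ℚ K := by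
      rw [Subgroup.index_mul_card, IsGalois.card_aut_eq_finrank]
    have h2 : Module.finrank ℚ (IntermediateField.fixedField N) * Nat.card N = Module.finrank ℚ K := by
      rw [← IntermediateField.finrank_fixedField_eq_card N, Module.finrank_mul_finrank]
    exact Nat.eq_of_mul_eq_mul_right hNpos (h1.trans h2.symm)
  have hcard : Nat.card Γ = Module.finrank ℚ (IntermediateField.fixedField N) := by
    rw [← hidx, hNΓ.symm.index_eq_card]
  have hdeg : 3 ≤ Module.finrank (IntermediateField.fixedField N) K := by
    rw [IntermediateField.finrank_fixedField_eq_card]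
    have h1 : Nat.card N ≠ 1 := fun h => hN ((Subgroup.eq_bot_iff_card N).2 h)
    obtain ⟨k, hk⟩ := hodd
    omega
  haveI : IsGalois ℚ (IntermediateField.fixedField N) := IsGalois.of_fixedField_normal_subgroup N
  refine exists_simple_degenerate_of_subfield_complement (IntermediateField.fixedField N) Γ hcΓ (fun g hg hres => ?_) hcard
    hdeg Φ₀ φ₀ hprim hndg
  -- an element of `Γ` restricting trivially lies in `N ∩ Γ = ⊥`
  have hgN : g ∈ N := by
    rw [← IntermediateField.fixingSubgroup_fixedField N, IntermediateField.mem_fixingSubgroup_iff]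
    intro x hx
    exact apply_algebraMap_of_restrictNormalHom_eq_one (IntermediateField.fixedField N) hres ⟨x, hx⟩
  have := hNΓ.disjoint
  rw [Subgroup.disjoint_def] at this
  exact this hgN hg

/-- **… Sylow form**: `N ◁ Gal(K/ℚ)` a normal subgroup of odd prime-power order `p^a` (`a ≥ 1`) with `p ∤ [Gal(K/ℚ) : N]`
(a normal Sylow `p`-subgroup, `p` odd) and `K^N` BAD ⟹ `K` BAD. [cite: Kubota1965, §2 and §4 Lemma 2]
[cite: Shimura1998, §6.2 Thm. 3 and §8.2 Prop. 26] [cite: Gordon1999HodgeAVSurvey, Thm. 6.4 and §9.3] -/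
theorem exists_simple_degenerate_of_fixedField_normal_sylow (N : Subgroup (K ≃ₐ[ℚ] K)) [N.Normal] {p a : ℕ}
    (hp : p.Prime) (hp2 : p ≠ 2) (ha : a ≠ 0) (hcardN : Nat.card N = p ^ a) (hndvd : ¬ p ∣ N.index)
    (Φ₀ : CMType (IntermediateField.fixedField N)) (φ₀ : IntermediateField.fixedField N →+* ℂ)
    (hprim : IsPrimitive (ℂ ≃+* ℂ) Φ₀.1 φ₀) (hndg : ¬ IsNondegenerate Φ₀) :
    ∃ (Φ : CMType K) (φ : K →+* ℂ) (X : AbelianVariety ℂ) (ι : 𝓞 K →+* End X)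
      (ϑ : K →+* Module.End ℂ (complexBetti X.X 1)),
      IsPrimitive (ℂ ≃+* ℂ) Φ.1 φ ∧ ¬ IsNondegenerate Φ ∧ IsCMTypeRealisation Φ X ι ϑ ∧ X.IsSimple ∧
      X.dim = Module.finrank ℚ K / 2 ∧
      ∃ m p : ℕ, ∃ y : complexBetti (⨁ fun _ : Fin m => X).X (2 * p), IsRationalClass y ∧
        IsOfHodgeType (⨁ fun _ : Fin m => X).dim (⨁ fun _ : Fin m => X).X (2 * p) p p y ∧
        y ∉ divisorClassesSpan (⨁ fun _ : Fin m => X).X (⨁ fun _ : Fin m => X).dim p := by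
  refine exists_simple_degenerate_of_fixedField_coprime_odd N ?_ ?_ ?_ Φ₀ φ₀ hprim hndg
  · rw [hcardN]
    exact (hp.odd_of_ne_two hp2).pow
  · intro h
    rw [Subgroup.eq_bot_iff_card N, hcardN] at h
    rcases pow_eq_one_iff.1 h with h1 | h1
    · exact hp.one_lt.ne' h1
    · exact ha h1
  · rw [hcardN]
    exact (Nat.Coprime.pow_left a ((Nat.Prime.coprime_iff_not_dvd hp).2 hndvd))

end Field

end Summit.HodgeConjecture.CorCM.GaloisModels

end
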